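import Mathlib
import HarnessLib.Audit
import Summits.PneNP.PneNP.Theorems.PstarChordReadOutside

/-!
# Restricting a G-constraint to constants: substitution of outside variables (ROUND-24, O1 at exact tightness; memo g21 §16)

FRONTIER range-avoidance ladder, rung F-N3, ROUND 24 (cell `pnp-ideate`, prover-2 memos `g20/O1-CHORD-READ-g20.md` §13.2 (induction frame on
outside variables), `g21/O1-CHORD-READ-g21.md` §16 (the general two-chord theorem: fibre arguments); typed target
`PstarCoreBoundTargets.TerminalPeelable` (p646951); restricted-model proof complexity — nothing here bears on `P` versus `NP`).

`PstarChordReadRestrict.terminal_restrict` takes the restricted readers as GIVEN G-constraints.  The fibre arguments of the general two-chord theorem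
need them CONSTRUCTED, for a whole list of variables at once:

* `avoid I G z` — the monomials of `G` not containing `z`;  `gval_split_var` — `Γ(x) = gval (C ∖ z) (avoid G z) x ⊕ x_z · mv z x`
  (the part of a G-constraint seen by one variable is `x_z` times its move);
* `restrict1 I C G z κ` — the G-constraint `Γ|_{x_z := κ}` in the remaining variables: `((C ∖ z) [∆ partners G z if κ], avoid G z)`;
  `gval_restrict1`: `gval (restrict1 …) x = Γ(x[z := κ]) ⊕ (κ ∧ z ∈ C)`; its monomials are among those of `G` (`restrict1_snd_subset`);
* `restrictL I C G L` for a list `L` of (variable, value) pairs, with `overrideL x L` (the point `x` overridden by `L`) and `constL`: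
  `gval_restrictL`: `gval (restrictL …) x = Γ(overrideL x L) ⊕ constL …`; `restrictL_snd_subset`; `solves_overrideL` (overriding outside
  variables keeps the core solved); `overrideL_apply_of_not_mem` / `overrideL_apply_of_mem` / `overrideL_eq_self` (bookkeeping).

No genericity, no Assumption A.
-/

set_option linter.dupNamespace false -- `Summit.PneNP.PneNP.…`: summit = sub-problem name (D-0017 single-conjunct layout)

open Finset Literature.Computability.Complexity
open scoped symmDiff
open Summit.PneNP.PneNP.Theorems.PstarFibrePolys (bit bit_injective bit_xor bit_and)
open Summit.PneNP.PneNP.Theorems.PstarSALevel (varSet SimpleOverlap)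
open Summit.PneNP.PneNP.Theorems.PstarGapOneAll (gval)
open Summit.PneNP.PneNP.Theorems.PstarGConstraint (bit_gval gval_update_of_forall_ne)
open Summit.PneNP.PneNP.Theorems.PstarGraphQuadGapTwoForms (sum_symmDiff_zmod2)
open Summit.PneNP.PneNP.Theorems.PstarGSystemFreeVar (gval_symmDiff)
open Summit.PneNP.PneNP.Theorems.PstarChordBridgeTools (coef)
open Summit.PneNP.PneNP.Theorems.PstarChordReadSwitch (solves_update_of_outside)
open Summit.PneNP.PneNP.Theorems.PstarChordReadFlip
open Summit.PneNP.PneNP.Theorems.PstarChordReadOutside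

namespace Summit.PneNP.PneNP.Theorems.PstarChordReadRestrictVar

variable {n m : ℕ}

/-! ## Splitting one variable off a G-constraint -/
section Split

variable (I : LocalMap 4 n m)

/-- The monomials of `G` **avoiding** the variable `z`. -/
def avoid (G : Finset (Fin m)) (z : Fin n) : Finset (Fin m) := G.filter fun g => I.vars g 2 ≠ z ∧ I.vars g 3 ≠ z

/-- `avoid G z ⊆ G`. -/
theorem avoid_subset (G : Finset (Fin m)) (z : Fin n) : avoid I G z ⊆ G := filter_subset _ _

/-- Membership in `avoid`. -/
theorem mem_avoid {G : Finset (Fin m)} {z : Fin n} {g : Fin m} : g ∈ avoid I G z ↔ g ∈ G ∧ I.vars g 2 ≠ z ∧ I.vars g 3 ≠ z := mem_filter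

/-- The monomials of `avoid G z` avoid `z`. -/
theorem avoid_spec (G : Finset (Fin m)) (z : Fin n) : ∀ g ∈ avoid I G z, I.vars g 2 ≠ z ∧ I.vars g 3 ≠ z :=
  fun _ hg => ((mem_avoid I).1 hg).2

/-- `bit (mv …) = coef …` (every element of `𝔽₂` is a bit). -/
theorem bit_mv (C : Finset (Fin n)) (G : Finset (Fin m)) (z : Fin n) (x : Fin n → Bool) :
    bit (mv I C G z x) = coef I C G z (fun w => bit (x w)) := by
  unfold mv
  generalize coef I C G z (fun w => bit (x w)) = t
  revert t; decide

/-- **SPLITTING A VARIABLE**: `Γ(x) = gval (C ∖ z) (avoid G z) x ⊕ x_z · mv z x` — the part of the G-constraint seen by `z` is `x_z` times its move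
(pure outputs: no monomial is `z·z`). -/
theorem gval_split_var (hI : I.IsPure xorAndPred) (C : Finset (Fin n)) (G : Finset (Fin m)) (z : Fin n) (x : Fin n → Bool) :
    gval I C G x = xor (gval I (C.erase z) (avoid I G z) x) (x z && mv I C G z x) := by
  classical
  apply bit_injective
  rw [bit_xor, bit_and, bit_mv, bit_gval, bit_gval]
  unfold coef avoid
  -- linear part
  have hC : ∑ v ∈ C, bit (x v) = ∑ v ∈ C.erase z, bit (x v) + bit (x z) * (if z ∈ C then 1 else 0) := by
    by_cases hz : z ∈ C
    · rw [← add_sum_erase C _ hz, if_pos hz, mul_one, add_comm]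
    · rw [erase_eq_of_notMem hz, if_neg hz, mul_zero, add_zero]
  -- monomial part, termwise
  have hG : ∀ g ∈ G, bit (x (I.vars g 2)) * bit (x (I.vars g 3)) =
      (if I.vars g 2 ≠ z ∧ I.vars g 3 ≠ z then bit (x (I.vars g 2)) * bit (x (I.vars g 3)) else 0) +
        bit (x z) * ((if I.vars g 2 = z then bit (x (I.vars g 3)) else 0) + (if I.vars g 3 = z then bit (x (I.vars g 2)) else 0)) := by
    intro g _
    have h23 : I.vars g 2 ≠ I.vars g 3 := fun e => absurd (hI.2 g e) (by decide)
    by_cases h2 : I.vars g 2 = z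
    · have h3 : I.vars g 3 ≠ z := fun e => h23 (h2.trans e.symm)
      rw [if_neg (fun h => h.1 h2), if_pos h2, if_neg h3, h2, add_zero, zero_add]
    · by_cases h3 : I.vars g 3 = z
      · rw [if_neg (fun h => h.2 h3), if_neg h2, if_pos h3, h3, zero_add, zero_add, mul_comm]
      · rw [if_pos ⟨h2, h3⟩, if_neg h2, if_neg h3, add_zero, mul_zero, add_zero]
  rw [sum_congr rfl hG, sum_add_distrib, ← mul_sum, ← sum_filter, hC]
  ring

end Split

/-! ## Restricting one variable -/
section One

variable (I : LocalMap 4 n m)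

/-- **`Γ|_{x_z := κ}` as a G-constraint in the other variables**: linear part `(C ∖ z)`, plus (symmetric difference) the partners of `z` when
`κ = 1`; monomials `avoid G z`.  (The constant `κ ∧ z ∈ C` is kept separately, `gval_restrict1`.) -/
def restrict1 (C : Finset (Fin n)) (G : Finset (Fin m)) (z : Fin n) : Bool → Finset (Fin n) × Finset (Fin m)
  | false => (C.erase z, avoid I G z)
  | true => ((C.erase z) ∆ partners I G z, avoid I G z)

/-- The monomials of the restriction are among those of `G`. -/
theorem restrict1_snd_subset (C : Finset (Fin n)) (G : Finset (Fin m)) (z : Fin n) (κ : Bool) : (restrict1 I C G z κ).2 ⊆ G := by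
  cases κ <;> exact avoid_subset I G z

/-- **`gval (restrict1 …) x = Γ(x[z := κ]) ⊕ (κ ∧ z ∈ C)`.** -/
theorem gval_restrict1 (hI : I.IsPure xorAndPred) (hS : SimpleOverlap I) (C : Finset (Fin n)) (G : Finset (Fin m)) (z : Fin n) (κ : Bool)
    (x : Fin n → Bool) :
    gval I (restrict1 I C G z κ).1 (restrict1 I C G z κ).2 x = xor (gval I C G (Function.update x z κ)) (κ && decide (z ∈ C)) := by
  classical
  have hzC : z ∉ C.erase z := notMem_erase z C
  rw [gval_split_var I hI C G z (Function.update x z κ), Function.update_self, gval_update_of_forall_ne I x hzC (avoid_spec I G z),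
    mv_update_self I C G hI, mv_eq_partners I hI hS]
  cases κ
  · show gval I (C.erase z) (avoid I G z) x = _
    cases gval I (C.erase z) (avoid I G z) x <;> rfl
  · show gval I ((C.erase z) ∆ partners I G z) (avoid I G z) x = _
    have e : avoid I G z ∆ (∅ : Finset (Fin m)) = avoid I G z := by
      rw [← Finset.bot_eq_empty]; exact symmDiff_bot _
    rw [← e, gval_symmDiff, e]
    cases gval I (C.erase z) (avoid I G z) x <;> cases gval I (partners I G z) ∅ x <;> cases decide (z ∈ C) <;> rfl

end One

/-! ## Restricting a list of variables -/
section Many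

variable (I : LocalMap 4 n m)

/-- Restriction of the variables of `L` (pairs (variable, value)), head LAST. -/
def restrictL (C : Finset (Fin n)) (G : Finset (Fin m)) : List (Fin n × Bool) → Finset (Fin n) × Finset (Fin m)
  | [] => (C, G)
  | p :: L => restrict1 I (restrictL C G L).1 (restrictL C G L).2 p.1 p.2

/-- The accumulated constant of `restrictL`. -/
def constL (C : Finset (Fin n)) (G : Finset (Fin m)) : List (Fin n × Bool) → Bool
  | [] => false
  | p :: L => xor (constL C G L) (p.2 && decide (p.1 ∈ (restrictL I C G L).1))

/-- The point `x` overridden by the assignments of `L` (head FIRST, then the tail on top). -/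
def overrideL (x : Fin n → Bool) : List (Fin n × Bool) → (Fin n → Bool)
  | [] => x
  | p :: L => overrideL (Function.update x p.1 p.2) L

omit I in
/-- `overrideL` on `[]` and on a cons (definitional unfoldings). -/
theorem overrideL_cons (x : Fin n → Bool) (p : Fin n × Bool) (L : List (Fin n × Bool)) :
    overrideL x (p :: L) = overrideL (Function.update x p.1 p.2) L := rfl

/-- The monomials of `restrictL` are among those of `G`. -/
theorem restrictL_snd_subset (C : Finset (Fin n)) (G : Finset (Fin m)) : ∀ L : List (Fin n × Bool), (restrictL I C G L).2 ⊆ G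
  | [] => Subset.refl _
  | p :: L => (restrict1_snd_subset I _ _ p.1 p.2).trans (restrictL_snd_subset C G L)

/-- **`gval (restrictL …) x = Γ(overrideL x L) ⊕ constL …`.** -/
theorem gval_restrictL (hI : I.IsPure xorAndPred) (hS : SimpleOverlap I) (C : Finset (Fin n)) (G : Finset (Fin m)) :
    ∀ (L : List (Fin n × Bool)) (x : Fin n → Bool),
      gval I (restrictL I C G L).1 (restrictL I C G L).2 x = xor (gval I C G (overrideL x L)) (constL I C G L)
  | [], x => by simp [restrictL, constL, overrideL]
  | p :: L, x => by
    show gval I (restrict1 I (restrictL I C G L).1 (restrictL I C G L).2 p.1 p.2).1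
        (restrict1 I (restrictL I C G L).1 (restrictL I C G L).2 p.1 p.2).2 x = _
    rw [gval_restrict1 I hI hS, gval_restrictL hI hS C G L (Function.update x p.1 p.2)]
    simp only [constL, overrideL]
    cases gval I C G (overrideL (Function.update x p.1 p.2) L) <;> cases constL I C G L <;>
      cases (p.2 && decide (p.1 ∈ (restrictL I C G L).1)) <;> rfl

omit I in
/-- Overriding does not touch variables outside the list. -/
theorem overrideL_apply_of_not_mem {v : Fin n} :
    ∀ (L : List (Fin n × Bool)) (x : Fin n → Bool), (∀ p ∈ L, p.1 ≠ v) → overrideL x L v = x v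
  | [], x, _ => rfl
  | p :: L, x, h => by
    rw [overrideL_cons, overrideL_apply_of_not_mem L _ (fun q hq => h q (List.mem_cons_of_mem _ hq)),
      Function.update_of_ne (h p List.mem_cons_self).symm]

omit I in
/-- Overriding sets the listed variables (keys without repetition). -/
theorem overrideL_apply_of_mem {z : Fin n} {κ : Bool} :
    ∀ (L : List (Fin n × Bool)) (x : Fin n → Bool), (L.map Prod.fst).Nodup → (z, κ) ∈ L → overrideL x L z = κ
  | [], _, _, h => absurd h List.not_mem_nil
  | p :: L, x, hnd, h => by
    rw [List.map_cons, List.nodup_cons] at hnd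
    rw [overrideL_cons]
    rcases List.mem_cons.1 h with e | hL
    · subst e
      rw [overrideL_apply_of_not_mem L _ (fun q hq hqz => hnd.1 (by rw [← hqz]; exact List.mem_map.2 ⟨q, hq, rfl⟩))]
      exact Function.update_self ..
    · exact overrideL_apply_of_mem L _ hnd.2 hL

omit I in
/-- Overriding by values the point already has does nothing. -/
theorem overrideL_eq_self : ∀ (L : List (Fin n × Bool)) (x : Fin n → Bool), (∀ p ∈ L, x p.1 = p.2) → overrideL x L = x
  | [], _, _ => rfl
  | p :: L, x, h => by
    rw [overrideL_cons, Function.update_eq_self_iff.2 (h p List.mem_cons_self).symm]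
    exact overrideL_eq_self L x fun q hq => h q (List.mem_cons_of_mem _ hq)

/-- Overriding OUTSIDE variables keeps the core solved. -/
theorem solves_overrideL {y : Fin m → Bool} {J₀ : Finset (Fin m)} :
    ∀ (L : List (Fin n × Bool)) (x : Fin n → Bool), (∀ p ∈ L, ∀ j ∈ J₀, p.1 ∉ varSet I j) → (∀ j ∈ J₀, I.eval x j = y j) →
      ∀ j ∈ J₀, I.eval (overrideL x L) j = y j
  | [], _, _, hx => hx
  | p :: L, x, h, hx => by
    rw [overrideL_cons]
    exact solves_overrideL L _ (fun q hq => h q (List.mem_cons_of_mem _ hq)) (solves_update_of_outside (h p List.mem_cons_self) hx p.2)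

omit I in
/-- The override agrees with `x` off the keys and is determined on the keys: two points with the same values off the keys have the same override. -/
theorem overrideL_congr : ∀ (L : List (Fin n × Bool)) (x x' : Fin n → Bool), (∀ v, (∀ p ∈ L, p.1 ≠ v) → x v = x' v) →
    overrideL x L = overrideL x' L
  | [], x, x', h => funext fun v => h v (fun _ hp => absurd hp List.not_mem_nil)
  | p :: L, x, x', h => by
    rw [overrideL_cons, overrideL_cons]
    refine overrideL_congr L _ _ fun v hv => ?_
    by_cases hpv : p.1 = v
    · subst hpv; rw [Function.update_self, Function.update_self]
    · rw [Function.update_of_ne (Ne.symm hpv), Function.update_of_ne (Ne.symm hpv)]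
      exact h v fun q hq => by
        rcases List.mem_cons.1 hq with e | hq
        · rw [e]; exact hpv
        · exact hv q hq

end Many

end Summit.PneNP.PneNP.Theorems.PstarChordReadRestrictVar
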